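import Literature.Topology.FourManifolds.KirbyMovesSlideSweepPlanar
import Literature.Topology.FourManifolds.AmbientIsotopyTransport
import HarnessLib

/-!
# The handle-slide sweep, planar part III: supported pushes, the twist diffeomorphism and conjugation

Topic `Literature/Topology/FourManifolds`; fact seat `provefact-IsStrictHandleSlide.isSurgery`
(R. C. Kirby, *The Topology of 4-Manifolds*, LNM 1374 (1989), Ch. I §4, p. 10 and §5 Thm. 5.1
(1); remaining content in the tree: the named fact (S)
`Literature.Topology.FourManifolds.FramedLink.IsStrictHandleSlide.slideModel`,
`KirbyMovesHandleSlide.lean`). Continuation of `KirbyMovesSlideSweepPlanar.lean`. The sweep of a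
meridian slice across the centre of the disc `Δ` is a horizontal push read in a *twisted chart*
`Λ` of the slice; to keep its support inside the pillbox around `Δ` one needs (i) a push whose
support is governed by the tracks of the pushed points only, (ii) the twist as a diffeomorphism
with an explicit inverse on the disc where it is used, (iii) control of the support of the
conjugated isotopy `Λ⁻¹ ∘ G_t ∘ Λ`. Proved here (no definitions, no named facts):

* `Literature.Topology.FourManifolds.SlideSweep.exists_ambientIsotopy_horizontalPush_of_subset`
  — **supported horizontal push**: for smooth `d`, a set `S` of starting points, a compact `K`
  containing the segments `[z, z + d(z₁) e₀]`, `z ∈ S`, and any open `U ⊇ K`: an ambient isotopy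
  `G`, stationary off a compact subset of `U`, with `G t z = z + ρ(t) d(z₁) e₀` for `z ∈ S`,
  `0 ≤ t ≤ 1` (`ρ` = `Real.smoothTransition`, so `G 1 z = z + d(z₁) e₀`); the field is
  `ρ'(t) d(y) ∂ₓ`, whose tracks through `S` never leave `K` (Hirsch (1976), Ch. 8 §1,
  Thms. 1.2–1.3).
* `Literature.Topology.FourManifolds.SlideSweep.twist_formula_inverse` — the twist formulas with
  parameters `λ` and `λ⁻¹` are mutually inverse (algebra of `tan (u/2) ↦ λ tan (u/2)`).
* `Literature.Topology.FourManifolds.SlideSweep.exists_twistDiffeomorph` — **the twist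
  diffeomorphism** `Λ` of the plane: on the disc `‖z‖ ≤ r₃` it is the explicit circle-preserving
  map `r (a, b) ↦ r ((1 + a) - λ² (1 - a), 2 λ b) / ((1 + a) + λ² (1 - a))`, `λ = e^{c r}`, its
  inverse is the same map with `e^{-c r}`, and both preserve the norm there (stage `1` of
  `exists_ambientIsotopy_angularTwist`).
* `Literature.Topology.FourManifolds.SlideSweep.transfer_eq_self_of_norm_le` — **support of a
  conjugated isotopy**: if `F` is stationary off `B(0, ρ)`, `ρ ≤ r₃`, and `Λ`, `Λ⁻¹` preserve the
  norm on `‖z‖ ≤ r₃`, then `Λ⁻¹ ∘ F_t ∘ Λ` (`AmbientIsotopy.transfer F Λ.symm`,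
  `AmbientIsotopyTransport.lean`) is stationary off `B(0, ρ)`.

## References

* R. C. Kirby, *The Topology of 4-Manifolds*, LNM 1374, Springer (1989), Ch. I §4, §5 Thm. 5.1.
  [Kirby1989]
* M. W. Hirsch, *Differential Topology*, GTM 33, Springer (1976), Ch. 8 §1, Thms. 1.2–1.3.
  [HirschDT1976]
-/

open scoped Manifold ContDiff Topology
open Function Set Metric

noncomputable section

namespace Literature.Topology.FourManifolds

namespace SlideSweep

/-! ## The supported horizontal push -/

/-- The derivative of the time profile is smooth. [folklore] -/
theorem contDiff_deriv_smoothTransition : ContDiff ℝ ∞ (deriv Real.smoothTransition) := by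
  have h := Real.smoothTransition.contDiff.iterate_deriv 1
  simpa using h

/-- **Supported horizontal push.** Let `d : ℝ → ℝ` be smooth, `S` a set of starting points, `K`
a compact set containing every segment `{z + θ d(z 1) e₀ | 0 ≤ θ ≤ 1}`, `z ∈ S`, and `U ⊇ K`
open. Then there is an ambient isotopy `G` of the plane, stationary off a compact subset of `U`,
with `G t z = z + ρ(t) d(z 1) e₀` for `z ∈ S`, `0 ≤ t ≤ 1`, where `ρ = Real.smoothTransition`
(`ρ 0 = 0`, `ρ 1 = 1`): integrate the field `ρ'(t) d(y) ∂ₓ` cut off near `K`; its tracks through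
`S` are the segments, which stay in `K`. Hirsch (1976), Ch. 8 §1, Thms. 1.2–1.3.
[cite: HirschDT1976, Ch. 8 §1, Thm. 1.3] -/
theorem exists_ambientIsotopy_horizontalPush_of_subset {d : ℝ → ℝ} (hd : ContDiff ℝ ∞ d)
    {S K U : Set (EuclideanSpace ℝ (Fin 2))} (hK : IsCompact K) (hU : IsOpen U) (hKU : K ⊆ U)
    (hS : ∀ z ∈ S, ∀ θ ∈ Icc (0 : ℝ) 1, z + (θ * d (z 1)) • EuclideanSpace.single 0 1 ∈ K) :
    ∃ G : AmbientIsotopy 𝓘(ℝ, EuclideanSpace ℝ (Fin 2)) (EuclideanSpace ℝ (Fin 2)),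
      (∃ C : Set (EuclideanSpace ℝ (Fin 2)), IsCompact C ∧ C ⊆ U ∧ ∀ t, ∀ z ∉ C, G.toFun t z = z) ∧
      ∀ z ∈ S, ∀ t ∈ Icc (0 : ℝ) 1,
        G.toFun t z = z + (Real.smoothTransition t * d (z 1)) • EuclideanSpace.single 0 1 := by
  set Y : ℝ × EuclideanSpace ℝ (Fin 2) → EuclideanSpace ℝ (Fin 2) :=
    fun p ↦ (deriv Real.smoothTransition p.1 * d (p.2 1)) • EuclideanSpace.single 0 1 with hY
  have hYs : ContDiff ℝ ∞ Y :=
    ((contDiff_deriv_smoothTransition.comp contDiff_fst).mul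
      (hd.comp ((contDiff_apply 1).comp contDiff_snd))).smul contDiff_const
  set c : S → ℝ → EuclideanSpace ℝ (Fin 2) :=
    fun z t ↦ (z : EuclideanSpace ℝ (Fin 2)) +
      (Real.smoothTransition t * d ((z : EuclideanSpace ℝ (Fin 2)) 1)) • EuclideanSpace.single 0 1
    with hc
  have hc1 : ∀ (z : S) (t : ℝ), c z t 1 = (z : EuclideanSpace ℝ (Fin 2)) 1 := fun z t ↦ by
    simp [c]
  have hderiv : ∀ (z : S), ∀ t ∈ Ioo (-1 : ℝ) 2, HasDerivAt (c z) (Y (t, c z t)) t := by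
    intro z t _
    have h1 : HasDerivAt (fun t : ℝ ↦ Real.smoothTransition t * d ((z : EuclideanSpace ℝ (Fin 2)) 1))
        (deriv Real.smoothTransition t * d ((z : EuclideanSpace ℝ (Fin 2)) 1)) t :=
      (((Real.smoothTransition.contDiff (n := 1)).differentiable one_ne_zero) t).hasDerivAt.mul_const _
    have h2 := (h1.smul_const (EuclideanSpace.single (0 : Fin 2) (1 : ℝ))).const_add
      (z : EuclideanSpace ℝ (Fin 2))
    have hY' : Y (t, c z t) =
        (deriv Real.smoothTransition t * d ((z : EuclideanSpace ℝ (Fin 2)) 1)) •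
          EuclideanSpace.single 0 1 := by
      simp only [hY, hc1]
    rw [hY']
    exact h2
  have htrack : ∀ (z : S), ∀ t ∈ Ioo (-1 : ℝ) 2, c z t ∈ K := fun z t _ ↦
    hS z z.2 (Real.smoothTransition t) ⟨Real.smoothTransition.nonneg t, Real.smoothTransition.le_one t⟩
  obtain ⟨G, hGC, hGc⟩ := exists_ambientIsotopy_of_hasDerivAt hYs hderiv hK hU hKU htrack
  refine ⟨G, hGC, fun z hz t ht ↦ ?_⟩
  have := hGc ⟨z, hz⟩ t ht
  simpa [c] using this

/-- At time `1` the supported push is the full translation `z ↦ z + d(z 1) e₀` on `S`.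
[folklore] -/
theorem horizontalPush_one {d : ℝ → ℝ} {S : Set (EuclideanSpace ℝ (Fin 2))}
    {G : AmbientIsotopy 𝓘(ℝ, EuclideanSpace ℝ (Fin 2)) (EuclideanSpace ℝ (Fin 2))}
    (hG : ∀ z ∈ S, ∀ t ∈ Icc (0 : ℝ) 1,
      G.toFun t z = z + (Real.smoothTransition t * d (z 1)) • EuclideanSpace.single 0 1)
    {z : EuclideanSpace ℝ (Fin 2)} (hz : z ∈ S) :
    G.toFun 1 z = z + d (z 1) • EuclideanSpace.single 0 1 := by
  rw [hG z hz 1 ⟨zero_le_one, le_rfl⟩, Real.smoothTransition.one, one_mul]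

/-! ## The twist formulas are invertible -/

/-- **Inverting the twist.** Applying the twist formulas with parameter `λ⁻¹` to the output of
the formulas with parameter `λ` returns the input `(a, b)` (`tan (u/2) ↦ λ tan (u/2)` followed by
`tan (u/2) ↦ λ⁻¹ tan (u/2)`). [folklore] -/
theorem twist_formula_inverse {a b lam : ℝ} (hab : a ^ 2 + b ^ 2 = 1) (hlam : lam ≠ 0) :
    ((1 + ((1 + a) - lam ^ 2 * (1 - a)) / ((1 + a) + lam ^ 2 * (1 - a))) -
        lam⁻¹ ^ 2 * (1 - ((1 + a) - lam ^ 2 * (1 - a)) / ((1 + a) + lam ^ 2 * (1 - a)))) /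
      ((1 + ((1 + a) - lam ^ 2 * (1 - a)) / ((1 + a) + lam ^ 2 * (1 - a))) +
        lam⁻¹ ^ 2 * (1 - ((1 + a) - lam ^ 2 * (1 - a)) / ((1 + a) + lam ^ 2 * (1 - a)))) = a ∧
    2 * lam⁻¹ * (2 * lam * b / ((1 + a) + lam ^ 2 * (1 - a))) /
      ((1 + ((1 + a) - lam ^ 2 * (1 - a)) / ((1 + a) + lam ^ 2 * (1 - a))) +
        lam⁻¹ ^ 2 * (1 - ((1 + a) - lam ^ 2 * (1 - a)) / ((1 + a) + lam ^ 2 * (1 - a)))) = b := by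
  have ha2 : a ^ 2 ≤ 1 := by nlinarith [sq_nonneg b]
  have hl2 : 0 < lam ^ 2 := by positivity
  have hn : (1 + a) + lam ^ 2 * (1 - a) ≠ 0 := (twist_denom_pos hl2 ha2).ne'
  have h1A : 1 + ((1 + a) - lam ^ 2 * (1 - a)) / ((1 + a) + lam ^ 2 * (1 - a)) =
      2 * (1 + a) / ((1 + a) + lam ^ 2 * (1 - a)) := by
    field_simp
    ring
  have h1A' : 1 - ((1 + a) - lam ^ 2 * (1 - a)) / ((1 + a) + lam ^ 2 * (1 - a)) =
      2 * lam ^ 2 * (1 - a) / ((1 + a) + lam ^ 2 * (1 - a)) := by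
    field_simp
    ring
  have hden : 2 * (1 + a) / ((1 + a) + lam ^ 2 * (1 - a)) +
      lam⁻¹ ^ 2 * (2 * lam ^ 2 * (1 - a) / ((1 + a) + lam ^ 2 * (1 - a))) =
        4 / ((1 + a) + lam ^ 2 * (1 - a)) := by
    field_simp
    ring
  rw [h1A, h1A', hden]
  constructor
  · field_simp
    ring
  · field_simp
    ring

/-! ## Polar form of points of the plane -/

/-- Every point of the plane is `‖z‖ (a, b)` with `a² + b² = 1`. [folklore] -/
theorem exists_eq_norm_mul (z : EuclideanSpace ℝ (Fin 2)) :
    ∃ a b : ℝ, a ^ 2 + b ^ 2 = 1 ∧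
      z = (‖z‖ * a) • EuclideanSpace.single 0 1 + (‖z‖ * b) • EuclideanSpace.single 1 1 := by
  have hz : z = (z 0) • EuclideanSpace.single 0 1 + (z 1) • EuclideanSpace.single 1 1 := by
    ext i; fin_cases i <;> simp
  have hn : ‖z‖ = Real.sqrt (z 0 ^ 2 + z 1 ^ 2) := by
    conv_lhs => rw [hz]
    exact norm_smul_single_add_smul_single _ _
  by_cases h0 : z = 0
  · refine ⟨1, 0, by norm_num, ?_⟩
    rw [h0]; simp
  · have hpos : 0 < ‖z‖ := norm_pos_iff.2 h0
    refine ⟨z 0 / ‖z‖, z 1 / ‖z‖, ?_, ?_⟩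
    · rw [div_pow, div_pow, ← add_div, div_eq_one_iff_eq (pow_ne_zero 2 hpos.ne')]
      rw [hn, Real.sq_sqrt (by positivity)]
    · rw [mul_div_cancel₀ _ hpos.ne', mul_div_cancel₀ _ hpos.ne']
      exact hz

/-! ## The twist diffeomorphism -/

/-- **The twist diffeomorphism.** For `c : ℝ` and `r₃ : ℝ` there is a diffeomorphism `Λ` of the
plane such that, for `0 ≤ r ≤ r₃` and `a² + b² = 1`: `Λ` maps `r (a, b)` by the twist formulas with
`λ = e^{c r}`, `Λ⁻¹` maps `r (a, b)` by the twist formulas with `λ = e^{-c r}`, and consequently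
`‖Λ z‖ = ‖z‖ = ‖Λ⁻¹ z‖` for `‖z‖ ≤ r₃`. (`Λ` is the stage `1` of the angular twist isotopy
`exists_ambientIsotopy_angularTwist`; its inverse on the disc is identified by
`twist_formula_inverse` and injectivity.) [cite: HirschDT1976, Ch. 8 §1, Thm. 1.3] -/
theorem exists_twistDiffeomorph (c r₃ : ℝ) :
    ∃ Λ : EuclideanSpace ℝ (Fin 2) ≃ₘ⟮𝓘(ℝ, EuclideanSpace ℝ (Fin 2)), 𝓘(ℝ, EuclideanSpace ℝ (Fin 2))⟯
        EuclideanSpace ℝ (Fin 2),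
      (∀ (r a b : ℝ), 0 ≤ r → r ≤ r₃ → a ^ 2 + b ^ 2 = 1 →
        Λ ((r * a) • EuclideanSpace.single 0 1 + (r * b) • EuclideanSpace.single 1 1) =
          (r * (((1 + a) - Real.exp (c * r) ^ 2 * (1 - a)) /
              ((1 + a) + Real.exp (c * r) ^ 2 * (1 - a)))) • EuclideanSpace.single 0 1 +
          (r * (2 * Real.exp (c * r) * b /
              ((1 + a) + Real.exp (c * r) ^ 2 * (1 - a)))) • EuclideanSpace.single 1 1) ∧
      (∀ (r a b : ℝ), 0 ≤ r → r ≤ r₃ → a ^ 2 + b ^ 2 = 1 →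
        Λ.symm ((r * a) • EuclideanSpace.single 0 1 + (r * b) • EuclideanSpace.single 1 1) =
          (r * (((1 + a) - Real.exp (-(c * r)) ^ 2 * (1 - a)) /
              ((1 + a) + Real.exp (-(c * r)) ^ 2 * (1 - a)))) • EuclideanSpace.single 0 1 +
          (r * (2 * Real.exp (-(c * r)) * b /
              ((1 + a) + Real.exp (-(c * r)) ^ 2 * (1 - a)))) • EuclideanSpace.single 1 1) ∧
      (∀ z : EuclideanSpace ℝ (Fin 2), ‖z‖ ≤ r₃ → ‖Λ z‖ = ‖z‖ ∧ ‖Λ.symm z‖ = ‖z‖) := by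
  obtain ⟨G, -, hG⟩ := exists_ambientIsotopy_angularTwist c (r₃ := r₃) isOpen_univ (subset_univ _)
  set Λ := G.toDiffeomorph 1 with hΛ
  have hΛapp : ∀ z, Λ z = G.toFun 1 z := fun z ↦ rfl
  -- the action of `Λ` on the disc
  have hfwd : ∀ (r a b : ℝ), 0 ≤ r → r ≤ r₃ → a ^ 2 + b ^ 2 = 1 →
      Λ ((r * a) • EuclideanSpace.single 0 1 + (r * b) • EuclideanSpace.single 1 1) =
        (r * (((1 + a) - Real.exp (c * r) ^ 2 * (1 - a)) /
            ((1 + a) + Real.exp (c * r) ^ 2 * (1 - a)))) • EuclideanSpace.single 0 1 +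
        (r * (2 * Real.exp (c * r) * b /
            ((1 + a) + Real.exp (c * r) ^ 2 * (1 - a)))) • EuclideanSpace.single 1 1 := by
    intro r a b hr hr3 hab
    rw [hΛapp, hG r a b hr hr3 hab 1 ⟨zero_le_one, le_rfl⟩, mul_one]
  -- the inverse action: the formulas with `λ⁻¹ = e^{-c r}` are undone by `Λ`
  have hbwd : ∀ (r a b : ℝ), 0 ≤ r → r ≤ r₃ → a ^ 2 + b ^ 2 = 1 →
      Λ.symm ((r * a) • EuclideanSpace.single 0 1 + (r * b) • EuclideanSpace.single 1 1) =
        (r * (((1 + a) - Real.exp (-(c * r)) ^ 2 * (1 - a)) /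
            ((1 + a) + Real.exp (-(c * r)) ^ 2 * (1 - a)))) • EuclideanSpace.single 0 1 +
        (r * (2 * Real.exp (-(c * r)) * b /
            ((1 + a) + Real.exp (-(c * r)) ^ 2 * (1 - a)))) • EuclideanSpace.single 1 1 := by
    intro r a b hr hr3 hab
    set lam : ℝ := Real.exp (-(c * r)) with hlam
    have hlam0 : lam ≠ 0 := (Real.exp_pos _).ne'
    have hlaminv : lam⁻¹ = Real.exp (c * r) := by rw [hlam, Real.exp_neg, inv_inv]
    set N : ℝ := (1 + a) + lam ^ 2 * (1 - a) with hN
    set A : ℝ := ((1 + a) - lam ^ 2 * (1 - a)) / N with hA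
    set B : ℝ := 2 * lam * b / N with hB
    have ha2 : a ^ 2 ≤ 1 := by nlinarith [sq_nonneg b]
    have hNpos : 0 < N := twist_denom_pos (pow_pos (Real.exp_pos _) 2) ha2
    have hAB : A ^ 2 + B ^ 2 = 1 := twist_sq_add_sq hab hNpos.ne'
    obtain ⟨hinvA, hinvB⟩ := twist_formula_inverse hab hlam0
    -- `Λ (r (A, B)) = r (a, b)`
    have key : Λ ((r * A) • EuclideanSpace.single 0 1 + (r * B) • EuclideanSpace.single 1 1) =
        (r * a) • EuclideanSpace.single 0 1 + (r * b) • EuclideanSpace.single 1 1 := by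
      rw [hfwd r A B hr hr3 hAB, ← hlaminv]
      simp only [hA, hB, hN]
      rw [hinvA, hinvB]
    rw [← key, Diffeomorph.symm_apply_apply]
  refine ⟨Λ, hfwd, hbwd, fun z hz ↦ ?_⟩
  obtain ⟨a, b, hab, hzeq⟩ := exists_eq_norm_mul z
  set r : ℝ := ‖z‖ with hr
  have ha2 : a ^ 2 ≤ 1 := by nlinarith [sq_nonneg b]
  have hr0 : 0 ≤ r := norm_nonneg z
  constructor
  · calc ‖Λ z‖ = ‖Λ ((r * a) • EuclideanSpace.single 0 1 + (r * b) • EuclideanSpace.single 1 1)‖ := by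
          rw [← hzeq]
      _ = r := by
          rw [hfwd r a b hr0 hz hab]
          exact norm_angularTwist_formula hr0 hab
            (twist_denom_pos (pow_pos (Real.exp_pos _) 2) ha2).ne'
  · calc ‖Λ.symm z‖ =
        ‖Λ.symm ((r * a) • EuclideanSpace.single 0 1 + (r * b) • EuclideanSpace.single 1 1)‖ := by
          rw [← hzeq]
      _ = r := by
          rw [hbwd r a b hr0 hz hab]
          exact norm_angularTwist_formula hr0 hab
            (twist_denom_pos (pow_pos (Real.exp_pos _) 2) ha2).ne'

/-! ## Support of a conjugated isotopy -/

/-- **Support of the conjugated isotopy.** Let `F` be an ambient isotopy of the plane stationary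
off the open ball `B(0, ρ)`, `ρ ≤ r₃`, and `Λ` a diffeomorphism with `‖Λ z‖ = ‖z‖ = ‖Λ⁻¹ z‖` for
`‖z‖ ≤ r₃`. Then the conjugated isotopy `Λ⁻¹ ∘ F_t ∘ Λ` (`F.transfer Λ.symm`) is stationary off
`B(0, ρ)`: a point `y` with `‖Λ y‖ < ρ ≤ r₃` has `‖y‖ = ‖Λ⁻¹ (Λ y)‖ = ‖Λ y‖ < ρ`. [folklore] -/
theorem transfer_eq_self_of_norm_le
    {F : AmbientIsotopy 𝓘(ℝ, EuclideanSpace ℝ (Fin 2)) (EuclideanSpace ℝ (Fin 2))}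
    {Λ : EuclideanSpace ℝ (Fin 2) ≃ₘ⟮𝓘(ℝ, EuclideanSpace ℝ (Fin 2)), 𝓘(ℝ, EuclideanSpace ℝ (Fin 2))⟯
      EuclideanSpace ℝ (Fin 2)}
    {ρ r₃ : ℝ} (hρ : ρ ≤ r₃)
    (hΛ : ∀ z : EuclideanSpace ℝ (Fin 2), ‖z‖ ≤ r₃ → ‖Λ z‖ = ‖z‖ ∧ ‖Λ.symm z‖ = ‖z‖)
    (hF : ∀ t (z : EuclideanSpace ℝ (Fin 2)), ρ ≤ ‖z‖ → F.toFun t z = z)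
    (t : ℝ) (y : EuclideanSpace ℝ (Fin 2)) (hy : ρ ≤ ‖y‖) :
    (F.transfer Λ.symm).toFun t y = y := by
  rw [AmbientIsotopy.transfer_toFun]
  change Λ.symm (F.toFun t (Λ y)) = y
  have hΛy : ρ ≤ ‖Λ y‖ := by
    by_contra hlt
    push Not at hlt
    have h1 : ‖Λ y‖ ≤ r₃ := (hlt.le.trans hρ)
    have h2 : ‖Λ.symm (Λ y)‖ = ‖Λ y‖ := (hΛ _ h1).2
    rw [Diffeomorph.symm_apply_apply] at h2
    linarith
  rw [hF t _ hΛy, Diffeomorph.symm_apply_apply]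

/-- **Values of the conjugated isotopy**: `(F.transfer Λ.symm) t (Λ⁻¹ w) = Λ⁻¹ (F t w)`.
[folklore] -/
theorem transfer_symm_apply
    (F : AmbientIsotopy 𝓘(ℝ, EuclideanSpace ℝ (Fin 2)) (EuclideanSpace ℝ (Fin 2)))
    (Λ : EuclideanSpace ℝ (Fin 2) ≃ₘ⟮𝓘(ℝ, EuclideanSpace ℝ (Fin 2)), 𝓘(ℝ, EuclideanSpace ℝ (Fin 2))⟯
      EuclideanSpace ℝ (Fin 2))
    (t : ℝ) (w : EuclideanSpace ℝ (Fin 2)) :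
    (F.transfer Λ.symm).toFun t (Λ.symm w) = Λ.symm (F.toFun t w) := by
  rw [AmbientIsotopy.transfer_toFun]
  change Λ.symm (F.toFun t (Λ (Λ.symm w))) = Λ.symm (F.toFun t w)
  rw [Diffeomorph.apply_symm_apply]

end SlideSweep

end Literature.Topology.FourManifolds
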